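import Summits.BirchSwinnertonDyer.BirchSwinnertonDyer.Theorems.TameQuarticManinParityTprimeHeegnerUpperOfManinUnitComposition
import Summits.BirchSwinnertonDyer.BirchSwinnertonDyer.Theorems.TameQuarticManinParityTprimeHeegnerUpperOfManinUnitSigmaCruxAccounting
import Literature.NumberTheory.GaloisCohomology.PoitouTateFiniteShaDualityHolds
import HarnessLib

/-!
# Skeleton «rows_of_manin_unit» v3 for crux X₄ `TprimeHeegnerUpperOfManinUnit` (stmt-BirchSwinnertonDyer-23738; TQS r303 / TQMP r4)

v3 (this file; STAGED by the route pen bsd-wall-pss3x g15 after refill hand `leafhand-bsd-tamequarticmaninpa-5` g0's landed helpers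
p827050 / p827407 / p827485 / p827819 / p827999 / p828099 and its census c609f46fb33746f6, 2026-08-31 — NOT registered by the pen; registration
is an operator-write on a director word; v2 = 08412075024a8ca5, operator-write 2026-08-31T14:04:55Z). RESEARCH line — skeleton; NOT leaf
progress; BSD is not proved by this; no stub is closed; 23738 stays OPEN. WHAT CHANGED v2 → v3 AND WHY: the hand proved in the kernel
(`Theorems/TameQuarticManinParityTprimeHeegnerUpperOfManinUnitSigmaSwapCarrierBlind.lean` §3, `…SigmaCruxAccounting.lean` §1) that on a
Heegner frame in a field where `2` splits (the Friedberg–Hoffstein field of the socket) every depth `s′ ≤ ord₃ c_q(E)` at ANY single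
carrier `q ∣ N_E` (multiplicative OR additive) is paid by three NAMED Literature facts {Gross 1991 Prop. 3.7 (2), Poitou–Tate duality for
Selmer structures (conjugation-compatible form), [GZ86 III (3.1)] image-free} — so the research stub Σ (all irreducible optimal rows,
all depths) is REPLACED by (i) the two of those facts that have NO `_holds` (Prop. 3.7 (2), III (3.1) image-free), appended to the
CITE-ONLY print stub (7 → 9 names) — the third, `GaloisCohomology.poitouTate_selmerStructure_duality_conj`, is a THEOREM of sorry-free
Literature (`…poitouTate_selmerStructure_duality_conj_holds`, `GaloisCohomology/PoitouTateFiniteShaDualityHolds.lean`) and is cited BY NAME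
in the composition, never a stub (director (852)(a)) — and (ii) the INCREMENT
`stub_sigmaIncrementTwoSplit` (Σ⁺₂: Σ's binders + `SatisfiesHeegnerHypothesis 2 K` + the depth guard «every prime `q ∣ N_E` has
`ord₃ c_q(E) < s′`» — non-vacuous only on rows with ≥ 2 Tamagawa-`3` carriers; = Jetchev 2008 Conj. 1.3 beyond Thm. 1.4 /
Büyükboduk 2009 §4.2 Q1 at the additive prime 3; text = binder `hIncr` of the landed accounting theorem VERBATIM). p-stub, L₀ stub and r₃
VERBATIM v2; the two Manin-unit antecedents 23736 / 23737 are THEOREMS since p827167 (CDT 2025, kernel-closed, audit (P†) pending).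
Composition = ONE application of `…SigmaCruxAccounting` §1. Count class unchanged: r2 (Σ⁺₂, r₃) / p2 (print, reduction) / i1 (L₀@3 ⟸ 19981).
Honest reading of 23738 after v3: print(9) ⊕ {multi-carrier increment Σ⁺₂ at additive 3 (XL)} ⊕ {reducible rows r₃ (XL)} ⊕ {L₀@3 ⟸ KT 19981}.
[cite: Jetchev2008, Thm. 1.4 (p. 812), Conj. 1.3] [cite: Buyukboduk2009TamagawaDefect, §4.2 Question 1] [cite: GrossLMS1991, Prop. 3.7 (2), §6 p. 245]
[cite: MilneADT2006, Ch. I, Thm. 4.10(b)] [cite: GrossZagier1986, III (3.1)]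

v2 RECORD (kept verbatim below for the revision log).

v1 (linewriter-bsd-display13-1 g0, registered 2026-08-31T11:50:56Z by operator-write, sha 05f83a59255b2adc; r3/p1): p-stub
`stub_reduceToOptimalDatum` + research stubs r₁ `stub_ontoRowsOfManinUnit` / r₂ `stub_smallImageIrreducibleRowsOfManinUnit` /
r₃ `stub_reducibleRowsOfManinUnit`, split of the optimal rows by the image of `ρ̄_{E,3}`.

v2 (STAGED by the route pen bsd-wall-pss3x g15 after refill hand `leafhand-bsd-tamequarticmaninpa-3` g0's landed helpers
p823764 / p823868 / p824349 and its census 1e31cb8b02fc2948, 2026-08-31 — NOT registered by the pen; registration is an operator-write on a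
director word). RESEARCH line — skeleton; NOT leaf progress. BSD is not proved by this; no stub is closed; 23738 stays OPEN.

WHAT CHANGED AND WHY. The hand proved in the kernel (`Theorems/TameQuarticManinParityTprimeHeegnerUpperOfManinUnitIrreducibleRows.lean`
§3, `…Composition.lean` §1) that r₁ and r₂ follow from ONE displayed input Σ (global `3^{s′}`-divisibility of the derived Heegner points on
the irreducible optimal (t′) rank-one rows to depth `ord₃ ∏_ℓ c_ℓ(E)`, the Manin unit spent on `v₃(c) = 0`) + the non-CM (t′) rank-ZERO
LOWER half at 3 (for the Heegner twist) + PRINT — the onto / normaliser-of-Cartan split is not load-bearing (Matar–Nekovář 2019 Thm 0.7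
replaces Kolyvagin's surjective form). v2 therefore names exactly the remaining pieces:
* `stub_printInputs` **[print — CITE-ONLY; never a proof target, never benched, never a hand target]**: the seven published inputs the
  landed composition displays BY NAME (Gross–Zagier ∀, Kolyvagin ∀, GZK rank part, GZ I.(7.3), Matar–Nekovář 2019 Thm 0.7, newform
  existence, Friedberg–Hoffstein split-divisor twists) — tree named facts, each closes the moment its `_holds` lands.
* `stub_reduceToOptimalDatum` **[print-composite glue, p; FLAG «SubTprime-iso»]**: VERBATIM v1 (reduction to an X₀(N)-optimal datum:
  BCDT + Mazur–Swinnerton-Dyer/Stevens lattice clause + Cassels' isogeny invariance + GZK finiteness; isogeny invariance of `SubTprime`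
  at 3 is on paper, untyped).
* `stub_sigmaIrreducibleOptimalRows` **[research, XL — THE hand target on the irreducible rows]**: Σ VERBATIM as displayed by the landed
  theorems (= Jetchev 2008 Conj. 1.3 Σ-form / a Thm 1.4-type divisibility at the ADDITIVE prime 3; Jetchev's Thm 1.4 is printed for
  `p ∤ N` only). Landed reductions a hand may use: Σ is VACUOUS on the Tamagawa-3-free rows; on the mono-multiplicative-carrier rows Σ is
  route RHP's item 27492 `JetchevDivisibilityReadingS2` BY NAME (`…MonoCarrier.lean`, p824349); `c₃(E) = 2` on (t′) is a tree theorem.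
  Genuinely open: rows with ≥ 2 Tamagawa-3 carriers or an additive IV/IV* carrier.
* `stub_tprimeLowerHalfRankZeroAtThree` **[item-keyed — NOT a hand target]**: the non-CM (t′) rank-ZERO LOWER half at 3
  (`Typed.MissingLowerBoundAt V 3`), i.e. the weakest form the composition consumes (for the Heegner twist `E^{(d_K)}`). It closes BY NAME
  from route KT's item 19981 `KatoDescentTamePotSupersingular.TameLowerHalfRankZero` via the landed
  `tprimeLowerRankZero_three_of_tameLowerHalfRankZero` (p823764); per class it is bypassed by a twist-unit certificate
  (`SchneiderFree.Upper.TwistUnitFieldAt W 3`, Composition §2). Typed at p = 3 and non-CM on purpose: 19981 quantifies over every odd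
  (t′) prime and CM rows, strictly more than this line needs.
* `stub_reducibleRowsOfManinUnit` **[research, XL — hardest; needs ideation before a hand]**: VERBATIM v1 (rational 3-isogeny rows; no
  Heegner-point upper bound for Ш[3^∞] in print at an ADDITIVE Eisenstein prime — CGLS 2022 / CGS 2023 are good ordinary).
Composition `TprimeHeegnerUpperOfManinUnit_of`: ONE application of the landed core theorem
`Theorems.TprimeHeegnerUpperOfManinUnit.tprime_upper_three_rankOne_of_maninUnits_of_reduce_of_sigma_of_lowerRankZero_of_reducibleRows`
(the crux's own antecedents 23736 / 23737 supply the Manin unit on the optimal datum). Kernel-checked below; sorries = the five stubs.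
Count class: r2 (Σ, r₃) / p2 (print inputs, reduction) / i1 (L₀@3 ⟸ 19981). Honest reading: 23738 = print ⊕ {Σ at additive 3 (XL)} ⊕
{reducible rows (XL)} ⊕ {rank-zero (t′) lower half at 3, KT 19981 or twist-unit certificates}.
[cite: MatarNekovar2019, Thm. 0.7 (p. 456), §0.11 (p. 457)] [cite: Jetchev2008, Conj. 1.3, Thm. 1.4 (p. 812)] [cite: Kolyvagin1990, Thm. A]
[cite: GrossZagier1986, Thm. I.(6.3), (7.3)] [cite: FriedbergHoffstein1995, Thm. B] [cite: Cassels1965ArithmeticVIII, Thm. 1.3]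
[cite: BCDT2001, Thm. A] [cite: MazurSwinnertonDyer1974, §2] [cite: arXiv:2505.09121]
-/

set_option autoImplicit false
set_option linter.dupNamespace false

noncomputable section

open scoped Classical NumberField
open WeierstrassCurve IsDedekindDomain NumberField Literature Literature.NumberTheory.EllipticCurves
  Literature.NumberTheory.EllipticCurves.ModularForms
  Literature.NumberTheory.EllipticCurves.Rank1Residual
  Literature.NumberTheory.EllipticCurves.Rank1Residual.Typed
  Literature.NumberTheory.EllipticCurves.KrizLi2019
  Literature.NumberTheory.QuadraticFields
  Summit.BirchSwinnertonDyer.Rank1Residual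
  Summit.BirchSwinnertonDyer.Rank1Residual.Additive
  Summit.BirchSwinnertonDyer.Rank1Residual.X11b
  Summit.BirchSwinnertonDyer.Rank1Residual.X11b.Three
  Summit.BirchSwinnertonDyer.BirchSwinnertonDyer.Theses
  Summit.BirchSwinnertonDyer.BirchSwinnertonDyer.Theses.TameQuarticSolvent
  Summit.BirchSwinnertonDyer.BirchSwinnertonDyer.Theorems
  Summit.BirchSwinnertonDyer.BirchSwinnertonDyer.Theorems.SchneiderFree
  Summit.BirchSwinnertonDyer.BirchSwinnertonDyer.Theorems.RamifiedPairUpperBound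

namespace Summit.BirchSwinnertonDyer.BirchSwinnertonDyer.Cruxes.TprimeHeegnerUpperOfManinUnit.RowsOfManinUnit

/-- The hypothesis package «`(W, D)` is an X₀(N)-OPTIMAL datum on a non-CM (t′) rank-one row»
implies the typed upper half at 3 — quantified over all such data (VERBATIM v1; the antecedent of the reduction stub). -/
def UpperOnOptimalData : Prop :=
  ∀ (W : WeierstrassCurve ℚ) [W.IsElliptic] [W.IsGloballyMinimal] [NeZero (W.conductorNorm ℤ)],
    ¬ W.HasCM → Rank1Residual.Addv W 3 → Summit.BirchSwinnertonDyer.Rank1Residual.Additive.SubTprime W 3 →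
    W.analyticRank = 1 →
    ∀ (D : ModularParametrizationData W (W.conductorNorm ℤ)),
      (∀ z ∈ D.L.lattice, ∃ w ∈ periodLattice D.f, z = D.c * w) →
      (∀ (W' : WeierstrassCurve ℚ) [W'.IsElliptic] (D' : ModularParametrizationData W' (W.conductorNorm ℤ)),
          D'.f = D.f → D.modularDegree ≤ D'.modularDegree) →
      Rank1Residual.Typed.MissingUpperBoundAt W 3

/-- **[print — CITE-ONLY; never a proof target, never benched, never a hand target] `stub_printInputs`** (v3: 7 → 9 names; the two
appended NAMED Literature facts WITHOUT `_holds` — Gross 1991 Prop. 3.7 (2) `GrossLMS1991.prop37_2_frobeniusCongruence` and [GZ86 III (3.1)]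
image-free `Gross1991_heegnerPoint_sub_ratTorsion_mem_E0_imageFree` — pay, together with the Literature THEOREM
`GaloisCohomology.poitouTate_selmerStructure_duality_conj_holds` (cited by name in the composition), every single-carrier depth on 2-split
Heegner frames, `…SigmaSwapCarrierBlind` §3). The seven published inputs
displayed BY NAME by the landed composition (tree named facts, cite-tagged in Literature): Gross–Zagier (∀ levels/fields), Kolyvagin
(∀), the GZK rank part `rank_eq_analyticRank_of_analyticRank_le_one`, Gross–Zagier I.(7.3), Matar–Nekovář 2019 Thm 0.7 (structure of
`Ш[p^∞]` under irreducibility from global divisibility), existence of the attached newform, Friedberg–Hoffstein split-divisor twists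
with `L ≠ 0`. Each conjunct closes the moment its `_holds` lands. [cite: GrossZagier1986, Thm. I.(6.3), (7.3)] [cite: Kolyvagin1990, Thm. A]
[cite: MatarNekovar2019, Thm. 0.7] [cite: FriedbergHoffstein1995, Thm. B] [cite: BCDT2001, Thm. A] -/
theorem stub_printInputs :
    (∀ (N : ℕ) [NeZero N] (W : WeierstrassCurve ℚ) (K : Type) [Field K] [NumberField K], gross_zagier N W K) ∧
    (∀ (N : ℕ) [NeZero N] (W : WeierstrassCurve ℚ) (K : Type) [Field K] [NumberField K], kolyvagin N W K) ∧
    rank_eq_analyticRank_of_analyticRank_le_one ∧ GrossZagier1986_thm_I_7_3 ∧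
    MatarNekovar2019.thm07_padicValNat_card_sha_primary_add_le_of_globalDivisibility_of_irreducible ∧
    exists_isNewformOf ∧ friedbergHoffstein_exists_heegnerField_splitDivisors_twist_ne_zero ∧
    Literature.NumberTheory.EllipticCurves.GrossLMS1991.prop37_2_frobeniusCongruence ∧
    Literature.NumberTheory.EllipticCurves.Gross1991_heegnerPoint_sub_ratTorsion_mem_E0_imageFree := by
  sorry

/-- **[print-composite glue, p; FLAG «SubTprime-iso»] `stub_reduceToOptimalDatum`** (VERBATIM v1). The upper half on every optimal (t′)
datum gives the upper half on every (t′) curve: BCDT 2001 Thm A (a parametrisation exists) + Mazur–Swinnerton-Dyer 1974 / Stevens 1989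
(the isogeny class of a modular curve contains an X₀(N)-optimal curve whose minimal-degree parametrisation satisfies `Λ_E = c·Λ_f`) +
Cassels 1965 Thm 1.3 (isogeny invariance of the BSD quotient, tree fact `bsdRHS_eq_of_isIsogenous`, transport
`Rank1Residual.X12.missingUpperBoundAt_of_isIsogenous`) + GZK finiteness of Ш at `r_an = 1` + isogeny invariance of `¬CM`, `Addv`,
`SubTprime`, `r_an`. [cite: Cassels1965ArithmeticVIII, Thm. 1.3] [cite: BCDT2001, Thm. A] [cite: MazurSwinnertonDyer1974, §2] -/
theorem stub_reduceToOptimalDatum :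
    UpperOnOptimalData →
    ∀ (W : WeierstrassCurve ℚ) [W.IsElliptic] [W.IsGloballyMinimal],
      ¬ W.HasCM → Rank1Residual.Addv W 3 → Summit.BirchSwinnertonDyer.Rank1Residual.Additive.SubTprime W 3 →
      W.analyticRank = 1 → Rank1Residual.Typed.MissingUpperBoundAt W 3 := by
  sorry

/-- **[research, XL — hand / ideation target on the MULTI-CARRIER rows only] `stub_sigmaIncrementTwoSplit`** (Σ⁺₂; text = binder
`hIncr` of the landed `…SigmaCruxAccounting` §1/§2 VERBATIM). For an optimal-level datum `Dt` with `3 ∤ c(Dt)` of a non-CM (t′) rank-one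
curve with `E[3]` irreducible, a Heegner field `K` in which `2` SPLITS (odd discriminant, Heegner hypothesis at `N_E` and at `2`,
`L(E^{(d_K)},1) ≠ 0`) and the Heegner point `P = y_K`: at every depth `s′ ≤ ord₃ ∏_ℓ c_ℓ(E)` EXCEEDING `ord₃ c_q(E)` for EVERY prime
`q ∣ N_E` (so: only on rows with ≥ 2 Tamagawa-`3` carriers — on mono-carrier rows the guard is vacuous and the landed three-fact theorem
pays), every derived Kolyvagin class `P(n)` at a squarefree product of Kolyvagin primes of index ≥ `s′` is globally `3^{s′}`-divisible.
Open in print at any `p`: Jetchev 2008 Conj. 1.3 beyond Thm. 1.4 («max over carriers, never the sum»); Büyükboduk 2009 §4.2 Question 1;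
candidate roads named by the hand: a Kolyvagin-SYSTEM argument (one Kolyvagin prime reads a cyclic image of the `−ε` dual `⊕ ℤ/3^{t_i}`),
or the route's tame-quartic IMC road; Kim 2025 (arXiv:2505.09121) = per-class certificates on tower rows. Strictly WEAKER than v2's Σ
(two more hypotheses). [cite: Jetchev2008, Conj. 1.3, Thm. 1.4 (p. 812)] [cite: Buyukboduk2009TamagawaDefect, §4.2 Question 1]
[cite: MatarNekovar2019, §0.11] [cite: arXiv:2505.09121] -/
theorem stub_sigmaIncrementTwoSplit :
    ∀ (W : WeierstrassCurve ℚ) [W.IsElliptic] [W.IsGloballyMinimal] [NeZero (W.conductorNorm ℤ)]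
      (K : Type) [Field K] [NumberField K] (Dt : ModularParametrizationData W (W.conductorNorm ℤ))
      (H : HeegnerDatum (W.conductorNorm ℤ) (NumberField.discr K)) (ι : K →+* ℂ) (P : (W.baseChange K).toAffine.Point),
      ¬ W.HasCM → Addv W 3 → SubTprime W 3 → W.HasIrreducibleModPGaloisRep 3 → W.analyticRank = 1 →
      ¬ (3 : ℤ) ∣ Dt.c → IsImaginaryQuadratic K → SatisfiesHeegnerHypothesis (W.conductorNorm ℤ) K →
      SatisfiesHeegnerHypothesis 2 K →
      (W.quadraticTwist (NumberField.discr K : ℚ)).entireLFunction 1 ≠ 0 →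
      WeierstrassCurve.Affine.Point.map ι.toRatAlgHom P = heegnerPointComplex Dt H → ¬ IsOfFinAddOrder P →
      Odd (NumberField.discr K) →
      ∀ (s' : ℕ), (∀ (q : ℕ) [Fact q.Prime], q ∣ W.conductorNorm ℤ →
          padicValNat 3 ((W.baseChange ℚ_[q]).localTamagawaNumber ℤ_[q]) < s') →
      s' ≤ padicValNat 3 W.tamagawaProduct →
      ∀ (n : ℕ) (d : KolyvaginHeegnerData Dt H.β ι n), Squarefree n →
      (∀ ℓ ∈ n.primeFactors, Zhang2014.IsKolyvaginPrime (W.conductorNorm ℤ) W K 3 ℓ ∧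
        s' ≤ Zhang2014.kolyvaginIndex W 3 ℓ) → Koly.PDiv d 3 s' := by
  sorry

/-- **[item-keyed — NOT a hand target] `stub_tprimeLowerHalfRankZeroAtThree`.** The non-CM (t′) rank-ZERO LOWER half at 3,
`ord₃ Ш_an(V) ≤ ord₃ #Ш(V)` (`Typed.MissingLowerBoundAt V 3`), consumed for the Heegner twist `E^{(d_K)}`. Closes BY NAME from route KT's
item stmt-BirchSwinnertonDyer-19981 `KatoDescentTamePotSupersingular.TameLowerHalfRankZero` through the landed
`Theorems.TprimeHeegnerUpperOfManinUnit.tprimeLowerRankZero_three_of_tameLowerHalfRankZero` (p823764); bypassed class by class by a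
twist-unit certificate `SchneiderFree.Upper.TwistUnitFieldAt W 3` (Composition §2, `upper_three_of_irreducible_of_sigmaAtDatum_of_twistUnit`).
Typed at `p = 3`, non-CM — the weakest form the composition uses (19981 ranges over every odd (t′) prime and CM rows).
[cite: Kato2004Asterisque, Thm. 17.4] [cite: arXiv:2107.13726] -/
theorem stub_tprimeLowerHalfRankZeroAtThree :
    ∀ (V : WeierstrassCurve ℚ) [V.IsElliptic] [V.IsGloballyMinimal],
      ¬ V.HasCM → Addv V 3 → SubTprime V 3 → V.analyticRank = 0 → MissingLowerBoundAt V 3 := by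
  sorry

/-- **[research, XL — hardest; ideation before a hand] `stub_reducibleRowsOfManinUnit`** (r₃, VERBATIM v1). Optimal datum with
`3 ∤ c(D)`, `ρ̄_{E,3}` REDUCIBLE (rational 3-isogeny; 2 705 census classes), non-CM (t′) rank one ⇒ the typed upper half at 3. Nothing in
print at an additive Eisenstein prime (CGLS 2022 / CGS 2023 need good ordinary reduction at p); candidates: Kriz–Li congruences of
Heegner points mod 3 along the isogeny (a Heegner K with `y_K ∉ 3E(K)` makes the index exact), Eisenstein Kolyvagin systems, or the
route's solvent-quartic base change U/ℚ (good reduction above 3) and descent of the 3-part.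
[cite: CastellaGrossiLeeSkinner2022, Thm. A] [cite: KrizLi2019, Thm. 1.1] [cite: AgasheRibetStein2006] -/
theorem stub_reducibleRowsOfManinUnit :
    ∀ (W : WeierstrassCurve ℚ) [W.IsElliptic] [W.IsGloballyMinimal] [NeZero (W.conductorNorm ℤ)],
      ¬ W.HasCM → Rank1Residual.Addv W 3 → Summit.BirchSwinnertonDyer.Rank1Residual.Additive.SubTprime W 3 →
      ¬ W.HasIrreducibleModPGaloisRep 3 → W.analyticRank = 1 →
      ∀ (D : ModularParametrizationData W (W.conductorNorm ℤ)), ¬ (3 : ℤ) ∣ D.maninConstant →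
        Rank1Residual.Typed.MissingUpperBoundAt W 3 := by
  sorry

/-- **Composition (kernel): X₄ `TprimeHeegnerUpperOfManinUnit` (the registered TQS `crux_decl`) from the five stubs** — ONE application
of the landed accounting core (p828099, `…SigmaCruxAccounting` §1): the crux's own antecedents `hMi` / `hMr` (23736 / 23737, theorems since
p827167) supply the Manin `3`-unit on the optimal datum, `stub_reduceToOptimalDatum` reduces to that datum, print(9) + the Literature theorem `poitouTate_selmerStructure_duality_conj_holds`
(BY NAME) pay every single-carrier depth on a 2-split Heegner frame, Σ⁺₂ the multi-carrier increment, L₀@3 the twist's lower half, r₃ the reducible rows. -/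
theorem TprimeHeegnerUpperOfManinUnit_of :
    Summit.BirchSwinnertonDyer.BirchSwinnertonDyer.Theses.TameQuarticSolvent.TprimeHeegnerUpperOfManinUnit := by
  obtain ⟨hGZ, hKo, hGZK, hGZ73, hMN, hnf, hFH, h37, hF1⟩ := stub_printInputs
  intro hMi hMr
  exact _root_.Summit.BirchSwinnertonDyer.BirchSwinnertonDyer.Theorems.TprimeHeegnerUpperOfManinUnit.tprime_upper_three_rankOne_of_maninUnits_of_reduce_of_namedFacts_of_increment_of_lowerRankZero_of_reducibleRows
    hGZ hKo hGZK hGZ73 hMN hnf hFH hMi hMr stub_reduceToOptimalDatum h37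
    (fun K _ _ ↦ _root_.Literature.NumberTheory.GaloisCohomology.poitouTate_selmerStructure_duality_conj_holds K) hF1
    stub_sigmaIncrementTwoSplit stub_tprimeLowerHalfRankZeroAtThree stub_reducibleRowsOfManinUnit

/-- The `TameQuarticManinParity` twin of the crux (same item 23738, wanted_by TQMP r4) from the same five stubs. -/
theorem TprimeHeegnerUpperOfManinUnit_tqmp_of :
    Summit.BirchSwinnertonDyer.BirchSwinnertonDyer.Theses.TameQuarticManinParity.TprimeHeegnerUpperOfManinUnit := by
  obtain ⟨hGZ, hKo, hGZK, hGZ73, hMN, hnf, hFH, h37, hF1⟩ := stub_printInputs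
  intro hMi hMr
  exact _root_.Summit.BirchSwinnertonDyer.BirchSwinnertonDyer.Theorems.TprimeHeegnerUpperOfManinUnit.tprime_upper_three_rankOne_of_maninUnits_of_reduce_of_namedFacts_of_increment_of_lowerRankZero_of_reducibleRows
    hGZ hKo hGZK hGZ73 hMN hnf hFH hMi hMr stub_reduceToOptimalDatum h37
    (fun K _ _ ↦ _root_.Literature.NumberTheory.GaloisCohomology.poitouTate_selmerStructure_duality_conj_holds K) hF1
    stub_sigmaIncrementTwoSplit stub_tprimeLowerHalfRankZeroAtThree stub_reducibleRowsOfManinUnit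

end Summit.BirchSwinnertonDyer.BirchSwinnertonDyer.Cruxes.TprimeHeegnerUpperOfManinUnit.RowsOfManinUnit

end
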